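import Summits.BirchSwinnertonDyer.BirchSwinnertonDyer.Theorems.PrintCf2RamifiedOffTYZGenusPeriodSecondNorm
import HarnessLib

/-!
# THE KUMMER CLASSES OF A POINT OF `A : Y² = X³ + 4X` ARE UNRAMIFIED AWAY FROM `2`: at every valuation `w` with `w(2) = 1`, `w(X)`, `w(X − 2i)`, `w(X + 2i)`
# are SQUARES of the value group — hence the second-norm class `[N₀]` of the genus period has even valuation at every odd place of `ℍ′_n`
# (crux stmt-BirchSwinnertonDyer-20509 `RamifiedOffTYZOfFacts`, line `offtyz-v7`, LEAD g31, lineage cycle 32, part 2)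

HONEST FRAMING (cell `bsd-print-cf2`, route `PrintCf2`; `--supports stmt-BirchSwinnertonDyer-20509`; theorems only, `def`-free, no `sorry`).
BSD is not proved by any of this; no class is closed by this file; item 23431 (C⁺) and crux 20509 stay OPEN.

WHY.  After cycles 30–32 the conjecture-grade core of C⁺ on the visible R2 rows is ONE square-class question about ONE number of `ℍ′_n = L_n(i)`:
«`N₀ = N_{H(i)/M}(x(z_n) − 2i) ∉ ⟨i⟩·ℍ′²`» (p802722), equivalently «`X` of the `(1+i)`-half of `Z(n)` is not in `⟨i⟩·ℍ′²`» (cycle 32 part 1,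
`…OnePlusIDescent`).  The memo `Cruxes/RamifiedOffTYZOfFacts/Lines/offtyz_v7_OnePlusILadder.md` §3(d) explains why no reciprocity law and no local datum
AWAY FROM `2` can decide it: the class `[N₀]` is unramified at every odd place, and units are local norms in the unramified extension `H(i)/L(i)`.  THIS FILE
puts the first half of that sentence in the kernel, fact-free:

* §1 (any field `F`, any valuation `w : F → Γ₀` into a linearly ordered commutative group with zero, `w(2) = 1`, `im² = −1`; pure algebra):
  `valuation_im_eq_one` (`w(i) = 1`); ★ `isSquare_valuation_X_sub_twoIm` / `…_add_twoIm` / `…_X` — for every `(x, y)` with `y² = x³ + 4x`,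
  **`w(x − 2i)`, `w(x + 2i)`, `w(x)` are squares in `Γ₀`** (trichotomy on `w(x − 2i)` vs `1`: below `1` the other two factors of `y² = x(x−2i)(x+2i)` are
  units, above `1` all three factors have the same value and `w(y)² = w(x)³`).  [The divisor of `X − 2i` is `2(T⁺) − 2(O)` and `A` has good reduction off `2`.]
* §2 (by name): ★★ `isSquare_valuation_secondNorm` — granted the exact-descent identity `κ⁺_{ℍ′}(Z(d)) = [N₀]` (p800776) with `N₀ ≠ 0`: for every finite place
  `v` of `ℍ′_n` with `v(2) = 1`, **`v(N₀)` is a square** (even valuation); `isSquare_valuation_firstNorm` — the same for `κ⁰_{ℍ′}(Z(d)) = [N₁]`.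
  So `[N₁], [N₀]` lie in the finite subgroup of `ℍ′^×/ℍ′^{×2}` of classes unramified outside the primes above `2` («`2`-Selmer-type» classes): the open
  content of `stub_offTYZ_secondNormNonsquare_visR2` is carried entirely by the four completions `L(i)_𝔓 ≅ ℚ₂(i)` above `2` and by the `2`-torsion of the
  class group of `L(i)` with the `2`-adic primes split (memo §3(d)) — exactly the data the lineage's empirical law LAW Z⁺ is keyed on (`x32`, `[2,l,q]`, `(q/l)₄`).

References: [cite: SilvermanAEC2009, VII.2 Prop. 2.2 (`3 ord x = 2 ord y`), Prop. X.1.4, X.4 (the image of the Kummer map is unramified outside `S`)];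
[cite: TianYuanZhang2017, §3.1 (p0010 L11), Lemma 3.16]; tree: p800776 (`…GenusPeriodDescent`), p802722 (`…GenusPeriodSecondNorm`).
-/

noncomputable section

open scoped Classical

open WeierstrassCurve WeierstrassCurve.Affine WeierstrassCurve.Affine.Point
  Literature.NumberTheory.EllipticCurves Literature.NumberTheory.EllipticCurves.Rank1Residual
  Summit.BirchSwinnertonDyer.Rank1Residual
  Literature.NumberTheory.EllipticCurves.TianYuanZhang2017
  IsDedekindDomain NumberField

set_option autoImplicit false

namespace Summit.BirchSwinnertonDyer.PrintCf2.KummerOddPlaces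

/-! ## §1 Valuations of `x`, `x ∓ 2i` at places not above `2` -/

section Valuation

variable {F : Type*} [Field F] {Γ₀ : Type*} [LinearOrderedCommGroupWithZero Γ₀] (w : Valuation F Γ₀)

/-- In a linearly ordered commutative group with zero, `a² = 1 ⟹ a = 1`. [folklore] -/
theorem eq_one_of_sq_eq_one {a : Γ₀} (h : a ^ 2 = 1) : a = 1 :=
  le_antisymm ((pow_le_one_iff two_ne_zero).mp h.le) ((one_le_pow_iff two_ne_zero).mp h.ge)

/-- `w(i) = 1` for a square root `im` of `−1`. [folklore] -/
theorem valuation_im_eq_one {im : F} (him : im ^ 2 = -1) : w im = 1 :=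
  eq_one_of_sq_eq_one (by rw [← map_pow, him, Valuation.map_neg, Valuation.map_one])

/-- `w(2i) = 1` and `w(4i) = 1` when `w(2) = 1`. [folklore] -/
theorem valuation_twoIm_eq_one {im : F} (him : im ^ 2 = -1) (h2 : w 2 = 1) : w (2 * im) = 1 ∧ w (4 * im) = 1 := by
  have hi := valuation_im_eq_one w him
  refine ⟨by rw [map_mul, h2, hi, one_mul], ?_⟩
  rw [map_mul, show (4 : F) = 2 * 2 by norm_num, map_mul, h2, hi]; simp

/-- **Generic trichotomy lemma.**  If `y² = f·(f + c₂)·(f + c₃)` with `w(c₂) = w(c₃) = 1`, then `w(f)` is a square in the value group: below `1` the two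
other factors are units, at `1` trivially, above `1` all three factors have value `w(f)` and `w(y)² = w(f)³`. [cite: SilvermanAEC2009, VII.2 Prop. 2.2] -/
theorem isSquare_valuation_of_cubic {f c₂ c₃ y : F} (hc₂ : w c₂ = 1) (hc₃ : w c₃ = 1)
    (h : y ^ 2 = f * (f + c₂) * (f + c₃)) : IsSquare (w f) := by
  have hval : w y ^ 2 = w f * w (f + c₂) * w (f + c₃) := by rw [← map_pow, h, map_mul, map_mul]
  rcases lt_trichotomy (w f) 1 with hlt | heq1 | hgt
  · rw [w.map_add_eq_of_lt_right (by rwa [hc₂]), w.map_add_eq_of_lt_right (by rwa [hc₃]), hc₂, hc₃,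
      mul_one, mul_one] at hval
    exact ⟨w y, by rw [← hval, sq]⟩
  · exact ⟨1, by rw [heq1, mul_one]⟩
  · rw [w.map_add_eq_of_lt_left (by rwa [hc₂]), w.map_add_eq_of_lt_left (by rwa [hc₃])] at hval
    have hne : w f ≠ 0 := ne_of_gt (lt_trans zero_lt_one hgt)
    refine ⟨w y / w f, ?_⟩
    field_simp
    rw [hval, pow_succ, pow_two]

/-- ★ **`w(x − 2i)` is a square in the value group** for every point `(x, y)` of `A : y² = x³ + 4x` and every valuation `w` with `w(2) = 1`
(`y² = (x − 2i)·((x − 2i) + 2i)·((x − 2i) + 4i)`). [cite: SilvermanAEC2009, VII.2 Prop. 2.2, Prop. X.1.4] -/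
theorem isSquare_valuation_X_sub_twoIm {im x y : F} (him : im ^ 2 = -1) (h2 : w 2 = 1) (heq : y ^ 2 = x ^ 3 + 4 * x) :
    IsSquare (w (x - 2 * im)) := by
  obtain ⟨h2i, h4i⟩ := valuation_twoIm_eq_one w him h2
  exact isSquare_valuation_of_cubic w (f := x - 2 * im) (c₂ := 2 * im) (c₃ := 4 * im) (y := y) h2i h4i
    (by linear_combination heq + (4 * x) * him)

/-- ★ **`w(x + 2i)` is a square in the value group** (`y² = (x + 2i)·((x + 2i) − 2i)·((x + 2i) − 4i)`). [cite: SilvermanAEC2009, VII.2 Prop. 2.2, Prop. X.1.4] -/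
theorem isSquare_valuation_X_add_twoIm {im x y : F} (him : im ^ 2 = -1) (h2 : w 2 = 1) (heq : y ^ 2 = x ^ 3 + 4 * x) :
    IsSquare (w (x + 2 * im)) := by
  obtain ⟨h2i, h4i⟩ := valuation_twoIm_eq_one w him h2
  have h2i' : w (-(2 * im)) = 1 := by rw [Valuation.map_neg, h2i]
  have h4i' : w (-(4 * im)) = 1 := by rw [Valuation.map_neg, h4i]
  exact isSquare_valuation_of_cubic w (f := x + 2 * im) (c₂ := -(2 * im)) (c₃ := -(4 * im)) (y := y) h2i' h4i'
    (by linear_combination heq + (4 * x) * him)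

/-- ★ **`w(x)` is a square in the value group** (`y² = x·(x − 2i)·(x + 2i)`). [cite: SilvermanAEC2009, VII.2 Prop. 2.2, Prop. X.1.4] -/
theorem isSquare_valuation_X {im x y : F} (him : im ^ 2 = -1) (h2 : w 2 = 1) (heq : y ^ 2 = x ^ 3 + 4 * x) :
    IsSquare (w x) := by
  obtain ⟨h2i, -⟩ := valuation_twoIm_eq_one w him h2
  have h2i' : w (-(2 * im)) = 1 := by rw [Valuation.map_neg, h2i]
  exact isSquare_valuation_of_cubic w (f := x) (c₂ := -(2 * im)) (c₃ := 2 * im) (y := y) h2i' h2i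
    (by linear_combination heq + (4 * x) * him)

end Valuation

/-! ## §2 By name: the norm classes of the genus period are unramified at the odd places of `ℍ′_n` -/

section ByName

variable {n : ℕ}

/-- `w(8) = w(4) = 1` when `w(2) = 1`. [folklore] -/
theorem valuation_eight_four {F : Type*} [Field F] {Γ₀ : Type*} [LinearOrderedCommGroupWithZero Γ₀] (w : Valuation F Γ₀)
    (h2 : w 2 = 1) : w (-8) = 1 ∧ w 4 = 1 := by
  constructor
  · rw [Valuation.map_neg, show (8 : F) = 2 ^ 3 by norm_num, map_pow, h2, one_pow]
  · rw [show (4 : F) = 2 ^ 2 by norm_num, map_pow, h2, one_pow]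

/-- ★★ **THE SECOND NORM CLASS IS UNRAMIFIED AWAY FROM `2`.**  Granted the exact-descent identity `κ⁺_{ℍ′}(Z(d)) = [N₀]` (`N₀ = N_{H(i)/M}(x(z) − 2i)`,
p800776) with `N₀ ≠ 0`: for every finite place `v` of `ℍ′_n` not above `2` (`v(2) = 1`), **`v(N₀)` is a square of the value group** (even valuation).
[cite: SilvermanAEC2009, Prop. X.1.4, VII.2 Prop. 2.2] [cite: TianYuanZhang2017, §3.1 (p0011 L53–L66)] -/
theorem isSquare_valuation_secondNorm (D : GenusPointData n) {d : ℕ} {N₀ : D.H} (hN : N₀ ≠ 0)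
    (hEDp : twoDescentComponent (curveA.baseChange D.H).toAffine (2 * D.im) 0 (-(2 * D.im)) (D.Z d) = sqClass N₀)
    (v : HeightOneSpectrum (𝓞 D.H)) (h2 : v.valuation D.H 2 = 1) :
    IsSquare (v.valuation D.H N₀) := by
  set w := v.valuation D.H
  rcases hZ : D.Z d with _ | ⟨X, Y, hP⟩
  · rw [hZ, ← zero_def, twoDescentComponent_zero] at hEDp
    obtain ⟨s, hs⟩ := (sqClass_eq_one_iff hN).mp hEDp.symm
    exact ⟨w s, by rw [hs, map_pow, sq]⟩
  · have heq : Y ^ 2 = X ^ 3 + 4 * X := (curveA_nonsingular_iff X Y).mp hP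
    rw [hZ] at hEDp
    by_cases hX : X = 2 * D.im
    · rw [twoDescentComponent_some_of_eq hP hX] at hEDp
      have h8 : (2 * D.im - 0) * (2 * D.im - -(2 * D.im)) = -8 := by linear_combination (8 : D.H) * D.im_sq
      rw [h8] at hEDp
      obtain ⟨s, hs⟩ := (GenusPeriodKummer.sqClass_eq_iff_exists_sq (by norm_num) hN).mp hEDp
      have hprod : w N₀ = w s * w s := by
        have e := congrArg w hs
        rw [map_mul, (valuation_eight_four w h2).1, one_mul, map_pow, sq] at e
        exact e
      exact ⟨w s, hprod⟩
    · rw [twoDescentComponent_some_of_ne hP hX] at hEDp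
      have hX0 : X - 2 * D.im ≠ 0 := sub_ne_zero.mpr hX
      obtain ⟨s, hs⟩ := (GenusPeriodKummer.sqClass_eq_iff_exists_sq hX0 hN).mp hEDp
      obtain ⟨γ, hγ⟩ := isSquare_valuation_X_sub_twoIm w D.im_sq h2 heq
      have hγ0 : γ ≠ 0 := by
        intro h0; rw [h0, mul_zero] at hγ; exact hX0 ((Valuation.zero_iff w).mp hγ)
      have hprod : w N₀ * (γ * γ) = w s * w s := by
        have e := congrArg w hs
        rw [map_mul, map_pow, hγ, sq] at e
        rw [mul_comm]; exact e
      refine ⟨w s / γ, ?_⟩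
      rw [div_mul_div_comm, eq_div_iff (mul_ne_zero hγ0 hγ0)]
      exact hprod

/-- ★★ **THE FIRST NORM CLASS IS UNRAMIFIED AWAY FROM `2`** (same, for `κ⁰_{ℍ′}(Z(d)) = [N₁]`, `N₁ = N_{H/L} x(z)`).
[cite: SilvermanAEC2009, Prop. X.1.4, VII.2 Prop. 2.2] [cite: TianYuanZhang2017, §3.1 (p0011 L53–L66)] -/
theorem isSquare_valuation_firstNorm (D : GenusPointData n) {d : ℕ} {N₁ : D.H} (hN : N₁ ≠ 0)
    (hED0 : twoDescentComponent (curveA.baseChange D.H).toAffine 0 (2 * D.im) (-(2 * D.im)) (D.Z d) = sqClass N₁)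
    (v : HeightOneSpectrum (𝓞 D.H)) (h2 : v.valuation D.H 2 = 1) :
    IsSquare (v.valuation D.H N₁) := by
  set w := v.valuation D.H
  rcases hZ : D.Z d with _ | ⟨X, Y, hP⟩
  · rw [hZ, ← zero_def, twoDescentComponent_zero] at hED0
    obtain ⟨s, hs⟩ := (sqClass_eq_one_iff hN).mp hED0.symm
    exact ⟨w s, by rw [hs, map_pow, sq]⟩
  · have heq : Y ^ 2 = X ^ 3 + 4 * X := (curveA_nonsingular_iff X Y).mp hP
    rw [hZ] at hED0
    by_cases hX : X = 0
    · rw [twoDescentComponent_some_of_eq hP hX] at hED0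
      have h4 : ((0 : D.H) - 2 * D.im) * (0 - -(2 * D.im)) = 4 := by linear_combination (-(4 : D.H)) * D.im_sq
      rw [h4] at hED0
      obtain ⟨s, hs⟩ := (GenusPeriodKummer.sqClass_eq_iff_exists_sq (by norm_num) hN).mp hED0
      have hprod : w N₁ = w s * w s := by
        have e := congrArg w hs
        rw [map_mul, (valuation_eight_four w h2).2, one_mul, map_pow, sq] at e
        exact e
      exact ⟨w s, hprod⟩
    · rw [twoDescentComponent_some_of_ne hP hX, sub_zero] at hED0
      obtain ⟨s, hs⟩ := (GenusPeriodKummer.sqClass_eq_iff_exists_sq hX hN).mp hED0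
      obtain ⟨γ, hγ⟩ := isSquare_valuation_X w D.im_sq h2 heq
      have hγ0 : γ ≠ 0 := by
        intro h0; rw [h0, mul_zero] at hγ; exact hX ((Valuation.zero_iff w).mp hγ)
      have hprod : w N₁ * (γ * γ) = w s * w s := by
        have e := congrArg w hs
        rw [map_mul, map_pow, hγ, sq] at e
        rw [mul_comm]; exact e
      refine ⟨w s / γ, ?_⟩
      rw [div_mul_div_comm, eq_div_iff (mul_ne_zero hγ0 hγ0)]
      exact hprod

end ByName

end Summit.BirchSwinnertonDyer.PrintCf2.KummerOddPlaces

end
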